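import Mathlib
import Summits.ValiantsHypothesis.ValiantsHypothesis.Theorems.FifoMatchingNNNotVPSpreadCofactorLowDegree
import Summits.ValiantsHypothesis.ValiantsHypothesis.Theorems.ZeroOneTransfer.Negative.TopComponentFree
import Literature.Computability.AlgebraicComplexity.NestFreeMatchingPoly
import HarnessLib

/-!
# Route FifoMatching — crux `NNNotVP` (stmt-ValiantsHypothesis-11615), line `division_split`:
# stub B2 ⟺ its HOMOGENEOUS hyper-degree tier

Refines `spreadCofactorReduction_iff_hyperDegree` (stub B2 `stub_spreadCofactorReduction` ⟺ its
restriction to cofactors of total degree `> 2^⌊n^{1/8}⌋`): since initial forms are free for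
monotone circuits over `ℝ≥0` and `NN_n` is homogeneous
(`ZeroOneTransfer.Negative.complexity_topComponent_le`, `topComponent_mul`; cf. the companion `NNDivisionHard.HyperDegree.complexity_topComponent_cofactor_le` for stmt-21181), a cofactor `h` may be replaced
by its top-degree homogeneous component before trading — the certificate cost in the allowed budget
only drops.  Hence

* `spreadCofactorReduction_iff_homogeneousHyperDegree` — B2 ⟺ «for some `k`, every nonzero
  HOMOGENEOUS cofactor `h` of degree `> 2^⌊n^{1/8}⌋` can be traded for an `h'` with a monomial of
  support `≤ (log₂ n + k)^k` and `L₊(NN_n · h') ≤ 2^((log₂ n + log₂(L₊(NN_n h) + L₊(h)) + k)^k)`».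

Honest framing: a localisation of the OPEN stub B2; stubs Z / A / B2, the crux `NNNotVP` and
`VP ≠ VNP` stay OPEN (NOT proved).  No definitions, no named facts.
-/

noncomputable section

-- Sub = Summit single-conjunct layout: the duplicated namespace component is mandated by the tree.
set_option linter.dupNamespace false

namespace Summit.ValiantsHypothesis.ValiantsHypothesis.Theorems.FifoMatching.NNNotVP.DivisionSplit

open MvPolynomial Literature.Computability.AlgebraicComplexity
open Summit.ValiantsHypothesis.ValiantsHypothesis.Theorems.ZeroOneTransfer.Negative
open scoped NNReal BigOperators Classical

/-- **Stub B2 ⟺ its homogeneous hyper-degree tier** (by name: `spreadCofactorReduction_iff_hyperDegree`;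
the top-degree component of the cofactor is nonzero, homogeneous of the same degree, and its
certificate is no costlier — initial forms are free; the budget `2^((log₂ n + log₂ cost + k)^k)` is
monotone in the cost). [folklore] -/
theorem spreadCofactorReduction_iff_homogeneousHyperDegree :
    (∃ k : ℕ, ∀ (n : ℕ) (h : MvPolynomial (σ n) ℝ≥0), h ≠ 0 →
      ∃ h' : MvPolynomial (σ n) ℝ≥0, (∃ m ∈ h'.support, m.support.card ≤ (Nat.log 2 n + k) ^ k) ∧
        complexity (NN n * h') ≤
          2 ^ ((Nat.log 2 n + Nat.log 2 (complexity (NN n * h) + complexity h) + k) ^ k)) ↔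
    (∃ k : ℕ, ∀ (n : ℕ) (h : MvPolynomial (σ n) ℝ≥0), h ≠ 0 →
      h.IsHomogeneous h.totalDegree →
      2 ^ Nat.sqrt (Nat.sqrt (Nat.sqrt n)) < h.totalDegree →
      ∃ h' : MvPolynomial (σ n) ℝ≥0, (∃ m ∈ h'.support, m.support.card ≤ (Nat.log 2 n + k) ^ k) ∧
        complexity (NN n * h') ≤
          2 ^ ((Nat.log 2 n + Nat.log 2 (complexity (NN n * h) + complexity h) + k) ^ k)) := by
  rw [spreadCofactorReduction_iff_hyperDegree]
  constructor
  · rintro ⟨k, hk⟩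
    exact ⟨k, fun n h hh _ hd => hk n h hh hd⟩
  · rintro ⟨k, hk⟩
    refine ⟨k, fun n h hh hd => ?_⟩
    -- the top-degree component: nonzero, homogeneous, same degree, no costlier certificate
    have hne : topComponent (1 : σ n → ℕ) h ≠ 0 := topComponent_ne_zero _ hh
    have hhom0 : (topComponent (1 : σ n → ℕ) h).IsHomogeneous h.totalDegree := by
      unfold topComponent
      rw [weightedTotalDegree_one]
      exact weightedHomogeneousComponent_isWeightedHomogeneous h.totalDegree h
    have hdeg : (topComponent (1 : σ n → ℕ) h).totalDegree = h.totalDegree := hhom0.totalDegree hne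
    have hhom : (topComponent (1 : σ n → ℕ) h).IsHomogeneous
        (topComponent (1 : σ n → ℕ) h).totalDegree := hdeg.symm ▸ hhom0
    have h2 : complexity (topComponent (1 : σ n → ℕ) h) ≤ complexity h :=
      complexity_topComponent_le _ h
    have h1 : complexity (NN n * topComponent (1 : σ n → ℕ) h) ≤ complexity (NN n * h) := by
      have hNN : topComponent (1 : σ n → ℕ) (NN n) = NN n :=
        topComponent_eq_self_of_isWeightedHomogeneous _ (nestFreeMatchingPoly_isHomogeneous n)
      have hmul : topComponent (1 : σ n → ℕ) (NN n * h) = NN n * topComponent (1 : σ n → ℕ) h := by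
        rw [topComponent_mul, hNN]
      rw [← hmul]
      exact complexity_topComponent_le _ _
    obtain ⟨h', hm, hc⟩ := hk n _ hne hhom (by rw [hdeg]; exact hd)
    refine ⟨h', hm, hc.trans (Nat.pow_le_pow_right (by norm_num) (Nat.pow_le_pow_left ?_ k))⟩
    have hmono : Nat.log 2 (complexity (NN n * topComponent (1 : σ n → ℕ) h) +
          complexity (topComponent (1 : σ n → ℕ) h)) ≤
        Nat.log 2 (complexity (NN n * h) + complexity h) :=
      Nat.log_mono_right (Nat.add_le_add h1 h2)
    omega

end Summit.ValiantsHypothesis.ValiantsHypothesis.Theorems.FifoMatching.NNNotVP.DivisionSplit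

end
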